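import Mathlib
import Literature.Analysis.InnerProduct.WeinsteinBound
import Literature.MathematicalPhysics.QuantumLattice.Imbrie2016.LLA
import Literature.MathematicalPhysics.QuantumLattice.Imbrie2016.LocalLawCompactness
import HarnessLib

/-!
# Imbrie (2016) — the min–max DICTIONARY between the variational small-gap set and
# 'two eigenvalues within 2ε' (LocalLawCompactness' unformalised sentence, kernel-checked)

CITATION HEADER (lean-in-tree rule 2026-08-18). J. Z. Imbrie, *On many-body localization for quantum spin chains*,
J. Stat. Phys. **163** (2016) 998–1048, doi 10.1007/s10955-016-1508-x, arXiv:1403.7837 [ImbrieJSP2016], eq. (1.1)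
and assumption LLA(ν, C) eq. (1.3)/(5.2). WHAT IS REPRODUCED: nothing of the paper's proofs; this file closes the
'DICTIONARY (not formalised, by min–max …)' caveat of `LocalLawCompactness` (audit cell `pub-imbrie`, GAP (11)(ai)):
for a symmetric operator `T` on a finite-dimensional inner product space with Mathlib's eigenvalue enumeration
`λ = hT.eigenvalues hn` (multiplicity counted by the index),

* `exists_plane_of_abs_eigenvalues_sub_le` — two indices `i ≠ j` with `|λᵢ − λⱼ| ≤ 2ε` give a shift `μ` (the midpoint)
  and a two-dimensional subspace `W` (the span of the two eigenvectors) with `‖T x − μ x‖ ≤ ε ‖x‖` on `W`;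
* the converse `exists_ne_abs_eigenvalues_sub_le_of_plane` (the min–max direction): `‖T x − μ x‖ ≤ ε ‖x‖` on a
  two-dimensional `W` forces two DISTINCT indices with `|λ − μ| ≤ ε`, hence two eigenvalues (multiplicity counted)
  within `2ε` — proved by Parseval against a non-zero `x ∈ W` orthogonal to the (at most one) close eigenvector;
* the Hermitian-matrix forms `matrix_exists_plane_of_abs_eigenvalues_sub_le`,
  `matrix_exists_ne_abs_eigenvalues_sub_le_of_plane` for `Matrix.IsHermitian.eigenvalues` and `Matrix.toEuclideanLin`
  (through the re-indexing bridge of `Literature.Analysis.InnerProduct.WeinsteinBound`);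
* for the spin-chain Hamiltonian (1.1) of `LLA.lean`: the operator family `Hop γ n` (the matrix `H γ p` acting on
  `EuclideanSpace ℝ (Cfg n)`, parameters `t = (h, Γ, J)`), its LINEARITY in the couplings (`H_smul`, `Hop_smul` — so the
  positive homogeneity hypothesis of `ball_law_smallGap` holds), and the inclusion
  `setOf_SmallGap_subset_smallGap`: `{t | SmallGap γ δ (Params.ofTriple t)} ⊆ smallGap (Hop γ n) (δ/2)`, through which an
  upper bound for the law of the variational set bounds the LLA event `{min_{α≠β} |E_α − E_β| < δ}`, and the converse
  `smallGap_subset_setOf_SmallGap`: `smallGap (Hop γ n) ε ⊆ {t | SmallGap γ δ (Params.ofTriple t)}` for every `δ > 2ε`.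
  So linear (or power) laws in the resolution for the two families of events are equivalent up to the factor 2.

STATUS: elementary linear algebra, proved from Mathlib's spectral theorem; no named facts; LLA itself is NOT asserted.
-/

noncomputable section

open scoped InnerProductSpace
open Module

namespace Literature.MathematicalPhysics.QuantumLattice.Imbrie2016.SmallGapDictionary

section Operator

variable {𝕜 : Type*} [RCLike 𝕜] {E : Type*} [NormedAddCommGroup E] [InnerProductSpace 𝕜 E]
  [FiniteDimensional 𝕜 E] {T : E →ₗ[𝕜] E} {n : ℕ}

/-- [cite: ImbrieJSP2016, §1 eq. (1.1)] `![i, j]` is injective for `i ≠ j` (bookkeeping for the two-eigenvector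
plane). -/
theorem injective_vecPair {i j : Fin n} (hij : i ≠ j) : Function.Injective ![i, j] := by
  intro a c hac
  fin_cases a <;> fin_cases c <;> simp_all [hij.symm]

/-- [cite: ImbrieJSP2016, eq. (1.1), assumption LLA(ν, C)] **Close eigenvalues ⇒ an approximate two-dimensional
eigenspace.** For a symmetric operator `T` with eigenvalue enumeration `λ = hT.eigenvalues hn`, two indices `i ≠ j` with
`|λᵢ − λⱼ| ≤ 2ε` yield `μ = (λᵢ + λⱼ)/2` and the plane `W = span {bᵢ, bⱼ}` of the corresponding orthonormal eigenvectors,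
on which `‖T x − μ x‖ ≤ ε ‖x‖` (Parseval in the eigenbasis: only the coordinates `i, j` of `x ∈ W` are non-zero and there
`(λ − μ)² ≤ ε²`). -/
theorem exists_plane_of_abs_eigenvalues_sub_le (hT : T.IsSymmetric) (hn : finrank 𝕜 E = n)
    {i j : Fin n} (hij : i ≠ j) {ε : ℝ}
    (h : |hT.eigenvalues hn i - hT.eigenvalues hn j| ≤ 2 * ε) :
    ∃ μ : ℝ, ∃ W : Submodule 𝕜 E, finrank 𝕜 W = 2 ∧
      ∀ x ∈ W, ‖T x - (μ : 𝕜) • x‖ ≤ ε * ‖x‖ := by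
  classical
  have hε : 0 ≤ ε := by linarith [abs_nonneg (hT.eigenvalues hn i - hT.eigenvalues hn j)]
  have hab := abs_le.1 h
  have hi : (hT.eigenvalues hn i - (hT.eigenvalues hn i + hT.eigenvalues hn j) / 2) ^ 2 ≤ ε ^ 2 := by
    rw [← sq_abs]
    refine pow_le_pow_left₀ (abs_nonneg _) (abs_le.2 ⟨by linarith, by linarith⟩) 2
  have hj : (hT.eigenvalues hn j - (hT.eigenvalues hn i + hT.eigenvalues hn j) / 2) ^ 2 ≤ ε ^ 2 := by
    rw [← sq_abs]
    refine pow_le_pow_left₀ (abs_nonneg _) (abs_le.2 ⟨by linarith, by linarith⟩) 2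
  have hu : Orthonormal 𝕜 (⇑(hT.eigenvectorBasis hn) ∘ ![i, j]) :=
    (hT.eigenvectorBasis hn).orthonormal.comp _ (injective_vecPair hij)
  refine ⟨(hT.eigenvalues hn i + hT.eigenvalues hn j) / 2,
    Submodule.span 𝕜 (Set.range (⇑(hT.eigenvectorBasis hn) ∘ ![i, j])), ?_, ?_⟩
  · rw [finrank_span_eq_card hu.linearIndependent, Fintype.card_fin]
  · intro x hx
    obtain ⟨c, rfl⟩ := Submodule.mem_span_range_iff_exists_fun 𝕜 |>.1 hx
    -- the eigen-coordinates of `x` vanish off `{i, j}`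
    have hcoef : ∀ k : Fin n, k ≠ i → k ≠ j →
        ⟪hT.eigenvectorBasis hn k, ∑ t, c t • (⇑(hT.eigenvectorBasis hn) ∘ ![i, j]) t⟫_𝕜 = 0 := by
      intro k hki hkj
      rw [inner_sum]
      refine Finset.sum_eq_zero fun t _ => ?_
      have hne : k ≠ ![i, j] t := by fin_cases t <;> simp [hki, hkj]
      rw [inner_smul_right, Function.comp_apply,
        orthonormal_iff_ite.1 (hT.eigenvectorBasis hn).orthonormal k (![i, j] t), if_neg hne, mul_zero]
    have hterm : ∀ k : Fin n,
        (hT.eigenvalues hn k - (hT.eigenvalues hn i + hT.eigenvalues hn j) / 2) ^ 2 *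
            ‖⟪hT.eigenvectorBasis hn k, ∑ t, c t • (⇑(hT.eigenvectorBasis hn) ∘ ![i, j]) t⟫_𝕜‖ ^ 2 ≤
          ε ^ 2 * ‖⟪hT.eigenvectorBasis hn k, ∑ t, c t • (⇑(hT.eigenvectorBasis hn) ∘ ![i, j]) t⟫_𝕜‖ ^ 2 := by
      intro k
      by_cases hki : k = i
      · subst hki; exact mul_le_mul_of_nonneg_right hi (sq_nonneg _)
      by_cases hkj : k = j
      · subst hkj; exact mul_le_mul_of_nonneg_right hj (sq_nonneg _)
      rw [hcoef k hki hkj, norm_zero]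
      simp
    have hsq : ‖T (∑ t, c t • (⇑(hT.eigenvectorBasis hn) ∘ ![i, j]) t) -
          (((hT.eigenvalues hn i + hT.eigenvalues hn j) / 2 : ℝ) : 𝕜) •
            ∑ t, c t • (⇑(hT.eigenvectorBasis hn) ∘ ![i, j]) t‖ ^ 2 ≤
        (ε * ‖∑ t, c t • (⇑(hT.eigenvectorBasis hn) ∘ ![i, j]) t‖) ^ 2 := by
      rw [Literature.Analysis.InnerProduct.norm_sq_sub_smul_apply_eq_sum hT hn _ _, mul_pow,
        ← (hT.eigenvectorBasis hn).sum_sq_norm_inner_right (∑ t, c t • _), Finset.mul_sum]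
      exact Finset.sum_le_sum fun k _ => hterm k
    exact (pow_le_pow_iff_left₀ (norm_nonneg _) (mul_nonneg hε (norm_nonneg _)) two_ne_zero).1 hsq

/-- [cite: ImbrieJSP2016, eq. (1.1), assumption LLA(ν, C)] **An approximate two-dimensional eigenspace ⇒ two close
eigenvalues (min–max direction).** If `‖T x − μ x‖ ≤ ε ‖x‖` on a subspace `W` of dimension `2`, then two DISTINCT indices
`i ≠ j` of the enumeration `λ = hT.eigenvalues hn` satisfy `|λᵢ − μ| ≤ ε` and `|λⱼ − μ| ≤ ε` (multiplicity counted): were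
there at most one such index `k₀`, a non-zero `x ∈ W` orthogonal to `b_{k₀}` would have all its non-zero eigen-coordinates
at indices with `(λ − μ)² > ε²`, contradicting Parseval. -/
theorem exists_ne_abs_eigenvalues_sub_le_of_plane (hT : T.IsSymmetric) (hn : finrank 𝕜 E = n)
    {μ ε : ℝ} {W : Submodule 𝕜 E} (hW : finrank 𝕜 W = 2)
    (h : ∀ x ∈ W, ‖T x - (μ : 𝕜) • x‖ ≤ ε * ‖x‖) :
    ∃ i j : Fin n, i ≠ j ∧ |hT.eigenvalues hn i - μ| ≤ ε ∧ |hT.eigenvalues hn j - μ| ≤ ε := by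
  classical
  by_contra hcon
  push Not at hcon
  -- at most one index is `ε`-close to `μ`; name a candidate `k₀`
  have hn2 : 2 ≤ n := by
    rw [← hn, ← hW]; exact Submodule.finrank_le W
  obtain ⟨k₀, hk₀⟩ : ∃ k₀ : Fin n, ∀ k, |hT.eigenvalues hn k - μ| ≤ ε → k = k₀ := by
    by_cases hex : ∃ k, |hT.eigenvalues hn k - μ| ≤ ε
    · obtain ⟨k₀, hk₀⟩ := hex
      refine ⟨k₀, fun k hk => ?_⟩
      by_contra hne
      exact absurd hk₀ (not_le.2 (hcon k k₀ hne hk))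
    · push Not at hex
      exact ⟨⟨0, by omega⟩, fun k hk => absurd hk (not_le.2 (hex k))⟩
  -- a non-zero `x ∈ W` orthogonal to `b k₀`
  obtain ⟨x, hxW, hx0, hxk⟩ : ∃ x ∈ W, x ≠ 0 ∧ ⟪hT.eigenvectorBasis hn k₀, x⟫_𝕜 = 0 := by
    let f : W →ₗ[𝕜] 𝕜 := (innerSL 𝕜 (hT.eigenvectorBasis hn k₀)).toLinearMap ∘ₗ W.subtype
    have hker : f.ker ≠ ⊥ := by
      intro hbot
      have h1 := LinearMap.finrank_range_add_finrank_ker f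
      rw [hbot, finrank_bot, add_zero, hW] at h1
      have h2 : finrank 𝕜 (LinearMap.range f) ≤ 1 :=
        (Submodule.finrank_le _).trans (by rw [Module.finrank_self])
      omega
    obtain ⟨y, hy, hy0⟩ := Submodule.exists_mem_ne_zero_of_ne_bot hker
    refine ⟨(y : E), y.2, fun h0 => hy0 (Subtype.ext h0), ?_⟩
    simpa [f] using hy
  have hxpos : 0 < ‖x‖ := norm_pos_iff.2 hx0
  have hε : 0 ≤ ε := by
    have := (norm_nonneg _).trans (h x hxW)
    nlinarith
  -- eigen-coordinates: zero at the close index, so every non-zero coordinate sits at a far index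
  have hfar : ∀ k, ⟪hT.eigenvectorBasis hn k, x⟫_𝕜 ≠ 0 → ε ^ 2 < (hT.eigenvalues hn k - μ) ^ 2 := by
    intro k hk
    have hnot : ¬ |hT.eigenvalues hn k - μ| ≤ ε := fun hle => hk (hk₀ k hle ▸ hxk)
    rw [← sq_abs (hT.eigenvalues hn k - μ)]
    exact pow_lt_pow_left₀ (not_le.1 hnot) hε two_ne_zero
  have hle : ∀ k ∈ Finset.univ, ε ^ 2 * ‖⟪hT.eigenvectorBasis hn k, x⟫_𝕜‖ ^ 2 ≤
      (hT.eigenvalues hn k - μ) ^ 2 * ‖⟪hT.eigenvectorBasis hn k, x⟫_𝕜‖ ^ 2 := by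
    intro k _
    by_cases hk : ⟪hT.eigenvectorBasis hn k, x⟫_𝕜 = 0
    · rw [hk, norm_zero]; simp
    · exact mul_le_mul_of_nonneg_right (hfar k hk).le (sq_nonneg _)
  have hex : ∃ k ∈ Finset.univ, ε ^ 2 * ‖⟪hT.eigenvectorBasis hn k, x⟫_𝕜‖ ^ 2 <
      (hT.eigenvalues hn k - μ) ^ 2 * ‖⟪hT.eigenvectorBasis hn k, x⟫_𝕜‖ ^ 2 := by
    by_contra hnone
    push Not at hnone
    have hall : ∀ k, ⟪hT.eigenvectorBasis hn k, x⟫_𝕜 = 0 := by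
      intro k
      by_contra hk
      have hpos : 0 < ‖⟪hT.eigenvectorBasis hn k, x⟫_𝕜‖ ^ 2 := by positivity
      exact absurd (hnone k (Finset.mem_univ k)) (not_le.2 (mul_lt_mul_of_pos_right (hfar k hk) hpos))
    have hsum := (hT.eigenvectorBasis hn).sum_sq_norm_inner_right x
    simp only [hall, norm_zero] at hsum
    have : ‖x‖ ^ 2 = 0 := by simpa using hsum.symm
    exact hx0 (norm_eq_zero.1 (pow_eq_zero_iff two_ne_zero |>.1 this))
  have hlt := Finset.sum_lt_sum hle hex
  rw [← Finset.mul_sum, (hT.eigenvectorBasis hn).sum_sq_norm_inner_right x,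
    ← Literature.Analysis.InnerProduct.norm_sq_sub_smul_apply_eq_sum hT hn x μ, ← mul_pow] at hlt
  exact absurd (pow_le_pow_left₀ (norm_nonneg _) (h x hxW) 2) (not_le.2 hlt)

end Operator

/-! ### Hermitian matrices (Mathlib's `Matrix.IsHermitian.eigenvalues`, `Matrix.toEuclideanLin`) -/

section Matrix

open Matrix

variable {𝕜 : Type*} [RCLike 𝕜] {m : Type*} [Fintype m] [DecidableEq m]

/-- [cite: ImbrieJSP2016, eq. (1.1), assumption LLA(ν, C)] **Close eigenvalues ⇒ approximate plane, Hermitian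
matrices.** For a Hermitian matrix `A` and two distinct indices `α ≠ β` of Mathlib's enumeration `hA.eigenvalues` with
`|λ_α − λ_β| ≤ 2ε` there are `μ` and a two-dimensional `W ⊆ EuclideanSpace 𝕜 m` with `‖A x − μ x‖ ≤ ε ‖x‖` on `W`. -/
theorem matrix_exists_plane_of_abs_eigenvalues_sub_le {A : Matrix m m 𝕜} (hA : A.IsHermitian)
    {α β : m} (hαβ : α ≠ β) {ε : ℝ} (h : |hA.eigenvalues α - hA.eigenvalues β| ≤ 2 * ε) :
    ∃ μ : ℝ, ∃ W : Submodule 𝕜 (EuclideanSpace 𝕜 m), finrank 𝕜 W = 2 ∧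
      ∀ x ∈ W, ‖toEuclideanLin A x - (μ : 𝕜) • x‖ ≤ ε * ‖x‖ := by
  set e : Fin (Fintype.card m) ≃ m := Fintype.equivOfCardEq (Fintype.card_fin _) with he
  have hS : (toEuclideanLin A).IsSymmetric := isSymmetric_toEuclideanLin_iff.mpr hA
  have hα := Literature.Analysis.InnerProduct.isHermitian_eigenvalues_equivOfCardEq hA (e.symm α)
  have hβ := Literature.Analysis.InnerProduct.isHermitian_eigenvalues_equivOfCardEq hA (e.symm β)
  rw [Equiv.apply_symm_apply] at hα hβ
  rw [hα, hβ] at h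
  have hij : e.symm α ≠ e.symm β := fun h' => hαβ (e.symm.injective h')
  exact exists_plane_of_abs_eigenvalues_sub_le hS finrank_euclideanSpace hij h

/-- [cite: ImbrieJSP2016, eq. (1.1), assumption LLA(ν, C)] **Approximate plane ⇒ two close eigenvalues, Hermitian
matrices.** If `‖A x − μ x‖ ≤ ε ‖x‖` on a two-dimensional `W ⊆ EuclideanSpace 𝕜 m`, then two distinct indices
`α ≠ β` of `hA.eigenvalues` lie in `[μ − ε, μ + ε]`; in particular `|λ_α − λ_β| ≤ 2ε`. -/
theorem matrix_exists_ne_abs_eigenvalues_sub_le_of_plane {A : Matrix m m 𝕜} (hA : A.IsHermitian)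
    {μ ε : ℝ} {W : Submodule 𝕜 (EuclideanSpace 𝕜 m)} (hW : finrank 𝕜 W = 2)
    (h : ∀ x ∈ W, ‖toEuclideanLin A x - (μ : 𝕜) • x‖ ≤ ε * ‖x‖) :
    ∃ α β : m, α ≠ β ∧ |hA.eigenvalues α - μ| ≤ ε ∧ |hA.eigenvalues β - μ| ≤ ε ∧
      |hA.eigenvalues α - hA.eigenvalues β| ≤ 2 * ε := by
  set e : Fin (Fintype.card m) ≃ m := Fintype.equivOfCardEq (Fintype.card_fin _) with he
  have hS : (toEuclideanLin A).IsSymmetric := isSymmetric_toEuclideanLin_iff.mpr hA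
  obtain ⟨i, j, hij, hi, hj⟩ := exists_ne_abs_eigenvalues_sub_le_of_plane hS finrank_euclideanSpace hW h
  refine ⟨e i, e j, fun h' => hij (e.injective h'), ?_, ?_, ?_⟩
  · rwa [Literature.Analysis.InnerProduct.isHermitian_eigenvalues_equivOfCardEq hA i]
  · rwa [Literature.Analysis.InnerProduct.isHermitian_eigenvalues_equivOfCardEq hA j]
  · rw [Literature.Analysis.InnerProduct.isHermitian_eigenvalues_equivOfCardEq hA i,
      Literature.Analysis.InnerProduct.isHermitian_eigenvalues_equivOfCardEq hA j]
    have h1 := abs_le.1 hi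
    have h2 := abs_le.1 hj
    exact abs_le.2 ⟨by linarith, by linarith⟩

end Matrix

/-! ### The spin chain (1.1): linearity of `H` in the couplings and the dictionary for `SmallGap` -/

section Imbrie

open Matrix

/-- [cite: ImbrieJSP2016, §1 eq. (1.1)] The parameter space of an `n`-site box as a normed space: triples
`t = (h, Γ, J) ∈ ℝⁿ × ℝⁿ × ℝⁿ⁺¹` (cf. `Params.ofTriple`, `Laws.boxMeasure`). -/
abbrev Triple (n : ℕ) : Type := (Fin n → ℝ) × (Fin n → ℝ) × (Fin (n + 1) → ℝ)

/-- [cite: ImbrieJSP2016, §1 eq. (1.1)] The Hamiltonian (1.1) of the `n`-site box as a family of linear operators on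
`EuclideanSpace ℝ (Cfg n)` indexed by the coupling triple. -/
def Hop (γ : ℝ) (n : ℕ) : Triple n → (EuclideanSpace ℝ (Cfg n) →ₗ[ℝ] EuclideanSpace ℝ (Cfg n)) :=
  fun t => toEuclideanLin (H γ (Params.ofTriple t))

/-- [cite: ImbrieJSP2016, §1 eq. (1.1)] The diagonal energy is linear in the couplings. -/
theorem diagEnergy_smul {n : ℕ} (c : ℝ) (t : Triple n) (σ : Cfg n) :
    diagEnergy (Params.ofTriple (c • t)) σ = c * diagEnergy (Params.ofTriple t) σ := by
  unfold diagEnergy Params.ofTriple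
  simp only [Prod.smul_fst, Prod.smul_snd, Pi.smul_apply, smul_eq_mul]
  rw [mul_add, Finset.mul_sum, Finset.mul_sum]
  congr 1 <;> exact Finset.sum_congr rfl fun _ _ => by ring

/-- [cite: ImbrieJSP2016, §1 eq. (1.1)] The transverse (S^x) part is linear in the couplings. -/
theorem offDiag_smul {n : ℕ} (γ c : ℝ) (t : Triple n) (σ τ : Cfg n) :
    offDiag γ (Params.ofTriple (c • t)) σ τ = c * offDiag γ (Params.ofTriple t) σ τ := by
  unfold offDiag Params.ofTriple
  simp only [Prod.smul_fst, Prod.smul_snd, Pi.smul_apply, smul_eq_mul]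
  rw [Finset.mul_sum]
  refine Finset.sum_congr rfl fun i _ => ?_
  split_ifs <;> ring

/-- [cite: ImbrieJSP2016, §1 eq. (1.1)] LINEARITY OF (1.1) IN THE COUPLINGS at fixed `γ`: `H(γ; c·t) = c · H(γ; t)` for
every real `c`. -/
theorem H_smul {n : ℕ} (γ c : ℝ) (t : Triple n) :
    H γ (Params.ofTriple (c • t)) = c • H γ (Params.ofTriple t) := by
  ext σ τ
  simp only [H, Matrix.add_apply, Matrix.diagonal_apply, Matrix.of_apply, Matrix.smul_apply, smul_eq_mul,
    diagEnergy_smul, offDiag_smul]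
  split_ifs <;> ring

/-- [cite: ImbrieJSP2016, §1 eq. (1.1)] The operator family `Hop γ n` is linear, in particular positively homogeneous
of degree one in the couplings — the hypothesis `hH` of `LocalLawCompactness.ball_law_smallGap`. -/
theorem Hop_smul (γ : ℝ) (n : ℕ) (c : ℝ) (t : Triple n) : Hop γ n (c • t) = c • Hop γ n t := by
  unfold Hop
  rw [H_smul, map_smul]

/-- [cite: ImbrieJSP2016, §1 eq. (1.1)] `Hop_smul` in the exact shape of the positive-homogeneity hypothesis of
`ball_law_smallGap` / `smallGap_scaling`. -/
theorem Hop_posHomogeneous (γ : ℝ) (n : ℕ) :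
    ∀ c : ℝ, 0 < c → ∀ t : Triple n, Hop γ n (c • t) = c • Hop γ n t :=
  fun c _ t => Hop_smul γ n c t

/-- [cite: ImbrieJSP2016, eq. (1.3), assumption LLA(ν, C)] **DICTIONARY, ⊆.** The LLA event
`{min_{α≠β} |E_α − E_β| < δ}` of the box Hamiltonian (1.1) is contained in the variational small-gap set of
`LocalLawCompactness` at resolution `δ/2`; hence any upper bound for the law of `smallGap (Hop γ n) (δ/2)` bounds
`Laws.boxMeasure … {t | SmallGap γ δ (Params.ofTriple t)}`. -/
theorem setOf_SmallGap_subset_smallGap (γ δ : ℝ) (n : ℕ) :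
    {t : Triple n | SmallGap γ δ (Params.ofTriple t)} ⊆ LocalLawCompactness.smallGap (Hop γ n) (δ / 2) := by
  intro t ht
  obtain ⟨α, β, hαβ, hlt⟩ := ht
  have h2 : |(H_isHermitian γ (Params.ofTriple t)).eigenvalues α -
      (H_isHermitian γ (Params.ofTriple t)).eigenvalues β| ≤ 2 * (δ / 2) := by
    have : (2 : ℝ) * (δ / 2) = δ := by ring
    rw [this]; exact hlt.le
  obtain ⟨μ, W, hW, hx⟩ := matrix_exists_plane_of_abs_eigenvalues_sub_le (H_isHermitian γ (Params.ofTriple t)) hαβ h2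
  refine ⟨μ, W, hW, fun v hv => ?_⟩
  simpa [Hop] using hx v hv

/-- [cite: ImbrieJSP2016, eq. (1.3), assumption LLA(ν, C)] **DICTIONARY, ⊇.** Conversely the variational small-gap set
at resolution `ε` is contained in the LLA event at every `δ > 2ε`: an `ε`-approximate two-dimensional eigenspace forces
two eigenvalues (multiplicity counted) within `2ε`. Together with `setOf_SmallGap_subset_smallGap`: linear laws for the
two families of events are equivalent up to the factor `2` in the resolution. -/
theorem smallGap_subset_setOf_SmallGap (γ ε δ : ℝ) (hδ : 2 * ε < δ) (n : ℕ) :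
    LocalLawCompactness.smallGap (Hop γ n) ε ⊆ {t : Triple n | SmallGap γ δ (Params.ofTriple t)} := by
  intro t ht
  obtain ⟨μ, W, hW, hx⟩ := ht
  have hx' : ∀ x ∈ W, ‖toEuclideanLin (H γ (Params.ofTriple t)) x - ((μ : ℝ) : ℝ) • x‖ ≤ ε * ‖x‖ := by
    intro x hxW; simpa [Hop] using hx x hxW
  obtain ⟨α, β, hαβ, -, -, hgap⟩ :=
    matrix_exists_ne_abs_eigenvalues_sub_le_of_plane (H_isHermitian γ (Params.ofTriple t)) hW hx'
  exact ⟨α, β, hαβ, lt_of_le_of_lt hgap hδ⟩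

end Imbrie


end Literature.MathematicalPhysics.QuantumLattice.Imbrie2016.SmallGapDictionary

end
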